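import Literature.Geometry.Kaehler.ComplexTorusMaps
import Literature.NumberTheory.Transcendental.FormsAlgebra
import Mathlib.Logic.Equiv.Fin.Basic
import HarnessLib

/-!
# Coordinate `2`-forms on a complex torus: the basis `dxₐ ∧ dx_b` of `Alt²_ℝ(E; ℂ)`

Companion of `Literature/Geometry/Kaehler/ComplexTorusMaps.lean` / `ComplexTorusForms.lean`. For
a real-linear isomorphism `Φ : ℝ^ι ≃ E` (the period isomorphism of the complex torus
`E/Φ(ℤ^ι)`), the **lattice coordinates** `xₐ = eₐ* ∘ Φ⁻¹ : E → ℝ`, the complex-valued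
coordinate `1`-forms `dxₐ` and the **coordinate `2`-forms** `ε_{ab} = dxₐ ∧ dx_b ∈ Alt²_ℝ(E; ℂ)`
(Lange–Birkenhake (1992), §1.1.4: the invariant forms `dx_{i₁} ∧ ⋯ ∧ dx_{i_n}`, `i₁ < ⋯ < i_n`,
"form a basis of `H^n(X, ℂ)`" / of `IF^n(X)`):

* `ComplexTorus.coord Φ a`, `ComplexTorus.dx Φ a`, `ComplexTorus.coordForm Φ a b` and their
  values (`coordForm_apply`, `coordForm_apply_single`: `ε_{ab}(Φe_c, Φe_d) = δ_{ac}δ_{bd} - δ_{ad}δ_{bc}`),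
  antisymmetry (`coordForm_swap`, `coordForm_self`);
* the **expansion** of every `γ ∈ Alt²_ℝ(E; ℂ)` in lattice coordinates,
  `2 • γ = Σ_{a,b} γ(Φeₐ, Φe_b) • ε_{ab}` (`two_smul_eq_sum_coordForm`), whence
  `ComplexTorus.coordFormBasis Φ`: the `ε_{ab}`, `a < b`, form a `ℂ`-basis of `Alt²_ℝ(E; ℂ)`
  (for a linear order on `ι`), with coordinates `γ ↦ γ(Φeₐ, Φe_b)` (`coordFormBasis_repr`);
* the **action of the homomorphisms `mapMatrix A`** (integer matrices) on coordinate forms: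
  `xₐ ∘ ρ(A) = Σ_c A_{ac} x_c` for the real analytic representation `ρ(A) = Φ A Φ⁻¹`
  (`coord_realRep`) and `ε_{ab} ∘ ρ(A) = Σ_{c,d} A_{ac} A_{bd} ε_{cd}` (`coordForm_comp_realRep`), so
  that the `ℚ`-span (indeed the `ℤ`-span) of the coordinate forms is stable under every `A`
  (`coordForm_comp_realRep_mem_span`) — the rational structure of `H²(X; ℂ) ≅ Alt²_ℝ(E; ℂ)`.

## References

* H. Lange, Ch. Birkenhake, *Complex Abelian Varieties* (1992), §1.1.4, Prop. 1.1.20 and §1.1.2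
  (rational representation). [LangeBirkenhake1992]
-/

noncomputable section

open scoped Manifold ContDiff Topology
open Set Filter Finset

namespace Literature.Geometry.Kaehler

namespace ComplexTorus

variable {ι : Type*} {E : Type*} [NormedAddCommGroup E] [NormedSpace ℂ E] (Φ : (ι → ℝ) ≃L[ℝ] E)

/-! ### Lattice coordinates and coordinate forms -/

/-- The `a`-th lattice coordinate `xₐ = eₐ* ∘ Φ⁻¹ : E → ℝ`. [cite: LangeBirkenhake1992, §1.1.4] -/
def coord (a : ι) : E →L[ℝ] ℝ :=
  (ContinuousLinearMap.proj a).comp (Φ.symm : E →L[ℝ] (ι → ℝ))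

/-- `xₐ(v) = (Φ⁻¹ v)ₐ`. [folklore] -/
@[simp] theorem coord_apply (a : ι) (v : E) : coord Φ a v = Φ.symm v a := rfl

/-- `xₐ(Φ e_b) = δ_{ab}`. [folklore] -/
theorem coord_apply_single [DecidableEq ι] (a b : ι) :
    coord Φ a (Φ (Pi.single b (1 : ℝ))) = if a = b then 1 else 0 := by
  rw [coord_apply, ContinuousLinearEquiv.symm_apply_apply, Pi.single_apply]

/-- The complex-valued coordinate `1`-form `dxₐ`. [cite: LangeBirkenhake1992, §1.1.4] -/
def dx (a : ι) : E [⋀^Fin 1]→L[ℝ] ℂ :=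
  ContinuousAlternatingMap.ofSubsingleton ℝ E ℂ (0 : Fin 1) (Complex.ofRealCLM.comp (coord Φ a))

/-- `dxₐ(v) = xₐ(v₀)`. [folklore] -/
@[simp] theorem dx_apply (a : ι) (v : Fin 1 → E) : dx Φ a v = ((Φ.symm (v 0) a : ℝ) : ℂ) := by
  simp [dx]

/-- **The coordinate `2`-form** `ε_{ab} = dxₐ ∧ dx_b ∈ Alt²_ℝ(E; ℂ)`.
[cite: LangeBirkenhake1992, §1.1.4] -/
def coordForm (a b : ι) : E [⋀^Fin 2]→L[ℝ] ℂ := (dx Φ a).wedge (dx Φ b)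

/-- `ε_{ab}(v₀, v₁) = xₐ(v₀) x_b(v₁) - xₐ(v₁) x_b(v₀)`. [folklore] -/
theorem coordForm_apply (a b : ι) (v : Fin 2 → E) :
    coordForm Φ a b v = ((Φ.symm (v 0) a * Φ.symm (v 1) b - Φ.symm (v 1) a * Φ.symm (v 0) b : ℝ) : ℂ) := by
  rw [coordForm, ContinuousAlternatingMap.wedge_apply_one_one]
  simp

/-- `ε_{ba} = -ε_{ab}`. [folklore] -/
theorem coordForm_swap (a b : ι) : coordForm Φ b a = -coordForm Φ a b := by
  ext v
  rw [ContinuousAlternatingMap.neg_apply, coordForm_apply, coordForm_apply]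
  push_cast
  ring

/-- `ε_{aa} = 0`. [folklore] -/
theorem coordForm_self (a : ι) : coordForm Φ a a = 0 := by
  ext v
  rw [coordForm_apply]
  change _ = (0 : ℂ)
  push_cast
  ring

/-- **Values on the lattice basis**: `ε_{ab}(Φe_c, Φe_d) = δ_{ac} δ_{bd} - δ_{ad} δ_{bc}`. [folklore] -/
theorem coordForm_apply_single [DecidableEq ι] (a b c d : ι) :
    coordForm Φ a b ![Φ (Pi.single c 1), Φ (Pi.single d 1)] =
      ((if a = c then 1 else 0) * (if b = d then 1 else 0) -
        (if a = d then 1 else 0) * (if b = c then 1 else 0) : ℝ) := by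
  rw [coordForm_apply]
  simp only [Matrix.cons_val_zero, Matrix.cons_val_one, Matrix.cons_val_fin_one,
    ContinuousLinearEquiv.symm_apply_apply, Pi.single_apply]

/-! ### Expansion of a `2`-form in lattice coordinates -/

variable [Fintype ι]

/-- Expansion of a vector in the lattice basis: `v = Σₐ xₐ(v) • Φeₐ`. [folklore] -/
theorem eq_sum_coord_smul [DecidableEq ι] (v : E) : v = ∑ a, Φ.symm v a • Φ (Pi.single a (1 : ℝ)) := by
  conv_lhs => rw [← Φ.apply_symm_apply v, pi_eq_sum_univ (Φ.symm v)]
  rw [map_sum]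
  refine Finset.sum_congr rfl fun a _ ↦ ?_
  rw [map_smul]
  congr 1
  exact congrArg Φ (funext fun j ↦ by simp [Pi.single_apply, eq_comm])

/-- **Bilinear expansion** of a `2`-form: `γ(v₀, v₁) = Σ_{a,b} xₐ(v₀) x_b(v₁) γ(Φeₐ, Φe_b)`.
[folklore] -/
theorem apply_eq_sum_sum [DecidableEq ι] (γ : E [⋀^Fin 2]→L[ℝ] ℂ) (v : Fin 2 → E) :
    γ v = ∑ a, ∑ b, ((Φ.symm (v 0) a * Φ.symm (v 1) b : ℝ) : ℂ) *
      γ ![Φ (Pi.single a 1), Φ (Pi.single b 1)] := by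
  have hv : v = fun i ↦ ∑ a, Φ.symm (v i) a • Φ (Pi.single a (1 : ℝ)) :=
    funext fun i ↦ eq_sum_coord_smul Φ (v i)
  conv_lhs => rw [hv]
  have h1 := MultilinearMap.map_sum γ.toContinuousMultilinearMap.toMultilinearMap
    (fun i a ↦ Φ.symm (v i) a • Φ (Pi.single a (1 : ℝ)))
  simp only [ContinuousMultilinearMap.coe_coe, ContinuousAlternatingMap.coe_toContinuousMultilinearMap]
    at h1
  rw [h1, ← Fintype.sum_prod_type']
  refine Fintype.sum_equiv (finTwoArrowEquiv ι) _ _ fun r ↦ ?_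
  have h2 := MultilinearMap.map_smul_univ γ.toContinuousMultilinearMap.toMultilinearMap
    (fun i ↦ Φ.symm (v i) (r i)) (fun i ↦ Φ (Pi.single (r i) (1 : ℝ)))
  simp only [ContinuousMultilinearMap.coe_coe, ContinuousAlternatingMap.coe_toContinuousMultilinearMap]
    at h2
  rw [h2, Fin.prod_univ_two, Complex.real_smul]
  congr 2
  funext i
  fin_cases i <;> rfl

/-- **Expansion of a `2`-form in coordinate forms**: `2 • γ = Σ_{a,b} γ(Φeₐ, Φe_b) • ε_{ab}`
(bilinear expansion and antisymmetry). Lange–Birkenhake (1992), §1.1.4 (every invariant form is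
a combination of the `dx_I`). [cite: LangeBirkenhake1992, §1.1.4] -/
theorem two_smul_eq_sum_coordForm [DecidableEq ι] (γ : E [⋀^Fin 2]→L[ℝ] ℂ) :
    (2 : ℂ) • γ = ∑ a, ∑ b, γ ![Φ (Pi.single a 1), Φ (Pi.single b 1)] • coordForm Φ a b := by
  ext v
  have hswap : γ ![v 1, v 0] = -γ v := by
    have h : γ (v ∘ Equiv.swap (0 : Fin 2) 1) = -γ v := γ.map_swap v (by decide)
    rw [← h]
    congr 1
    funext i
    fin_cases i <;> rfl
  have h0 := apply_eq_sum_sum Φ γ v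
  have h1 := apply_eq_sum_sum Φ γ ![v 1, v 0]
  simp only [Matrix.cons_val_zero, Matrix.cons_val_one, Matrix.cons_val_fin_one] at h1
  rw [ContinuousAlternatingMap.smul_apply, smul_eq_mul, two_mul,
    show γ v + γ v = γ v - γ ![v 1, v 0] by rw [hswap]; ring, h0, h1]
  simp only [ContinuousAlternatingMap.sum_apply, ContinuousAlternatingMap.smul_apply, smul_eq_mul,
    coordForm_apply]
  rw [← Finset.sum_sub_distrib]
  refine Finset.sum_congr rfl fun a _ ↦ ?_
  rw [← Finset.sum_sub_distrib]
  refine Finset.sum_congr rfl fun b _ ↦ ?_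
  push_cast
  ring

/-! ### The basis of coordinate forms -/

section Basis

variable [LinearOrder ι]

/-- The index set of the coordinate basis: pairs `a < b`. [folklore] -/
abbrev Pairs (ι : Type*) [LinearOrder ι] : Type _ := {p : ι × ι // p.1 < p.2}

/-- **The coordinate `2`-forms `ε_{ab}`, `a < b`, are linearly independent** (evaluate on
`(Φe_c, Φe_d)`, `c < d`). [cite: LangeBirkenhake1992, §1.1.4] -/
theorem linearIndependent_coordForm :
    LinearIndependent ℂ (fun p : Pairs ι ↦ coordForm Φ p.1.1 p.1.2) := by
  classical
  rw [Fintype.linearIndependent_iff]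
  intro g hg p
  have h := congrArg (fun γ : E [⋀^Fin 2]→L[ℝ] ℂ ↦ γ ![Φ (Pi.single p.1.1 1), Φ (Pi.single p.1.2 1)]) hg
  simp only [ContinuousAlternatingMap.sum_apply, ContinuousAlternatingMap.smul_apply, smul_eq_mul,
    coordForm_apply_single, ContinuousAlternatingMap.coe_zero, Pi.zero_apply] at h
  rw [Finset.sum_eq_single p] at h
  · simpa [ne_of_lt p.2, (ne_of_lt p.2).symm] using h
  · intro q _ hq
    have hq' : ¬ (q.1.1 = p.1.1 ∧ q.1.2 = p.1.2) := fun hh ↦ hq (Subtype.ext (Prod.ext hh.1 hh.2))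
    have hlt : ¬ (q.1.1 = p.1.2 ∧ q.1.2 = p.1.1) := fun hh ↦ by
      have := q.2; rw [hh.1, hh.2] at this; exact absurd (p.2.trans this) (lt_irrefl _)
    push_cast
    rw [not_and_or] at hq' hlt
    rcases hq' with h1 | h1 <;> rcases hlt with h2 | h2 <;> simp [h1, h2]
  · intro hp; exact absurd (Finset.mem_univ p) hp

omit [Fintype ι] in
/-- Every coordinate form lies in the span of the `ε_{ab}`, `a < b`. [folklore] -/
theorem coordForm_mem_span (a b : ι) :
    coordForm Φ a b ∈ Submodule.span ℂ (Set.range fun p : Pairs ι ↦ coordForm Φ p.1.1 p.1.2) := by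
  rcases lt_trichotomy a b with h | rfl | h
  · exact Submodule.subset_span ⟨⟨(a, b), h⟩, rfl⟩
  · rw [coordForm_self]; exact Submodule.zero_mem _
  · rw [coordForm_swap]
    exact Submodule.neg_mem _ (Submodule.subset_span ⟨⟨(b, a), h⟩, rfl⟩)

/-- The coordinate forms `ε_{ab}`, `a < b`, span `Alt²_ℝ(E; ℂ)`. [cite: LangeBirkenhake1992, §1.1.4] -/
theorem span_coordForm_eq_top :
    Submodule.span ℂ (Set.range fun p : Pairs ι ↦ coordForm Φ p.1.1 p.1.2) = ⊤ := by
  classical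
  rw [eq_top_iff]
  intro γ _
  have h : γ = (2⁻¹ : ℂ) • ((2 : ℂ) • γ) := by rw [smul_smul]; norm_num
  rw [h, two_smul_eq_sum_coordForm Φ γ]
  refine Submodule.smul_mem _ _ (Submodule.sum_mem _ fun a _ ↦ Submodule.sum_mem _ fun b _ ↦ ?_)
  exact Submodule.smul_mem _ _ (coordForm_mem_span Φ a b)

/-- **The basis of coordinate `2`-forms** `(ε_{ab})_{a<b}` of `Alt²_ℝ(E; ℂ)` (`E ≅ ℝ^ι` via `Φ`).
Lange–Birkenhake (1992), §1.1.4 / Prop. 1.1.20. [cite: LangeBirkenhake1992, §1.1.4] -/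
def coordFormBasis : Module.Basis (Pairs ι) ℂ (E [⋀^Fin 2]→L[ℝ] ℂ) :=
  Module.Basis.mk (linearIndependent_coordForm Φ) (span_coordForm_eq_top Φ).ge

/-- The basis vectors are the coordinate forms. [folklore] -/
@[simp] theorem coordFormBasis_apply (p : Pairs ι) : coordFormBasis Φ p = coordForm Φ p.1.1 p.1.2 :=
  Module.Basis.mk_apply _ _ p

/-- **Coordinates in the basis are the values on the lattice basis**:
`(γ)_{ab} = γ(Φeₐ, Φe_b)` for `a < b`. [cite: LangeBirkenhake1992, §1.1.4] -/
theorem coordFormBasis_repr (γ : E [⋀^Fin 2]→L[ℝ] ℂ) (p : Pairs ι) :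
    (coordFormBasis Φ).repr γ p = γ ![Φ (Pi.single p.1.1 1), Φ (Pi.single p.1.2 1)] := by
  classical
  conv_rhs => rw [← (coordFormBasis Φ).sum_repr γ]
  simp only [ContinuousAlternatingMap.sum_apply, ContinuousAlternatingMap.smul_apply, smul_eq_mul,
    coordFormBasis_apply, coordForm_apply_single]
  rw [Finset.sum_eq_single p]
  · simp [ne_of_lt p.2, (ne_of_lt p.2).symm]
  · intro q _ hq
    have hq' : ¬ (q.1.1 = p.1.1 ∧ q.1.2 = p.1.2) := fun hh ↦ hq (Subtype.ext (Prod.ext hh.1 hh.2))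
    have hlt : ¬ (q.1.1 = p.1.2 ∧ q.1.2 = p.1.1) := fun hh ↦ by
      have := q.2; rw [hh.1, hh.2] at this; exact absurd (p.2.trans this) (lt_irrefl _)
    push_cast
    rw [not_and_or] at hq' hlt
    rcases hq' with h1 | h1 <;> rcases hlt with h2 | h2 <;> simp [h1, h2]
  · intro hp; exact absurd (Finset.mem_univ p) hp

end Basis

/-! ### Action of homomorphisms on coordinate forms -/

/-- **Lattice coordinates transform by the rational representation**:
`xₐ ∘ ρ(A) = Σ_c A_{ac} x_c` for `ρ(A) = realRep Φ Φ A = Φ A Φ⁻¹`. Lange–Birkenhake (1992),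
§1.1.2. [cite: LangeBirkenhake1992, §1.1.2] -/
theorem coord_realRep (A : Matrix ι ι ℤ) (a : ι) (v : E) :
    coord Φ a (realRep Φ Φ A v) = ∑ c, (A a c : ℝ) * coord Φ c v := by
  have h := realRep_apply (Φ := Φ) (Φ' := Φ) A (Φ.symm v)
  rw [ContinuousLinearEquiv.apply_symm_apply] at h
  rw [coord_apply, h, ContinuousLinearEquiv.symm_apply_apply]
  simp [Matrix.mulVec, dotProduct]

/-- **Coordinate forms transform by `Λ²` of the rational representation**:
`ε_{ab} ∘ ρ(A) = Σ_{c,d} A_{ac} A_{bd} ε_{cd}`. Lange–Birkenhake (1992), §1.1.2 / §1.1.4.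
[cite: LangeBirkenhake1992, §1.1.4] -/
theorem coordForm_comp_realRep (A : Matrix ι ι ℤ) (a b : ι) :
    (coordForm Φ a b).compContinuousLinearMap (realRep Φ Φ A) =
      ∑ c, ∑ d, ((A a c * A b d : ℤ) : ℂ) • coordForm Φ c d := by
  ext v
  rw [ContinuousAlternatingMap.compContinuousLinearMap_apply, coordForm_apply]
  simp only [Function.comp_apply, ContinuousAlternatingMap.sum_apply, ContinuousAlternatingMap.smul_apply,
    smul_eq_mul, coordForm_apply]
  have h : ∀ (c : ι) (w : E), Φ.symm (realRep Φ Φ A w) c = ∑ d, (A c d : ℝ) * Φ.symm w d :=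
    fun c w ↦ coord_realRep Φ A c w
  simp only [h]
  push_cast
  rw [Finset.sum_mul_sum, Finset.sum_mul_sum, ← Finset.sum_sub_distrib]
  refine Finset.sum_congr rfl fun c _ ↦ ?_
  rw [← Finset.sum_sub_distrib]
  refine Finset.sum_congr rfl fun d _ ↦ ?_
  ring

/-- **The rational structure is stable under homomorphisms**: `ε_{ab} ∘ ρ(A)` lies in the
`ℚ`-span of the coordinate forms for every integer matrix `A`. [cite: LangeBirkenhake1992, §1.1.4] -/
theorem coordForm_comp_realRep_mem_span (A : Matrix ι ι ℤ) (a b : ι) {s : Set (E [⋀^Fin 2]→L[ℝ] ℂ)}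
    (hs : ∀ c d, coordForm Φ c d ∈ Submodule.span ℚ s) :
    (coordForm Φ a b).compContinuousLinearMap (realRep Φ Φ A) ∈ Submodule.span ℚ s := by
  rw [coordForm_comp_realRep]
  refine Submodule.sum_mem _ fun c _ ↦ Submodule.sum_mem _ fun d _ ↦ ?_
  convert zsmul_mem (hs c d) (A a c * A b d) using 1
  exact Int.cast_smul_eq_zsmul ℂ (A a c * A b d) (coordForm Φ c d)

end ComplexTorus

end Literature.Geometry.Kaehler
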